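import Summits.QuantumFields.YangMills.Theorems.UnitScaleTiltFluctuationComparisonRegPrRepAtHeightsV3FamBase
import Summits.QuantumFields.YangMills.Theorems.AlphaInputsT3ACv3Core
import HarnessLib

/-!
# `UnitScaleTiltFluctuationComparisonRegPrRepAtHeightsCoreV3Fam` — R-57χ (OWNER RULING g23-№2 + ADD. 5/6; definer's R57chi README «TO COME: `dataOfV3 ↦ dataOfV3chi`,
# V3FamBase/V3Fam On-χ (★r1/p2)»), part 1: THE DATUM OF A FAMILY OF DATA CORES `AlphaInputsT3AC.dataOfCoreV3 (p : ∀ K, PkgCoreV3 F 𝔠 γ hγ hγ1 K) π` and its (41)-SIDE ROWS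
# — `V3FamBase` §0–§3 stated ONCE over the row-stable core `AlphaInputsT3AC.PkgCoreV3` (★alpha-1's `AlphaInputsT3ACv3Core`), so that the old record (`PkgAtV3.toCore`) and the
# χ-record (`PkgAtV3Chi.toCore`) share them (crux `FluctuationComparisonRegPrIntL`, stmt-QuantumFields-20520; width-lever lane `ym-ust-19935-r1` g3)

Count-neutral helper (`--supports stmt-QuantumFields-20520`).  Proofs are `…RepAtHeightsV3FamBase`'s (ym-ust-19201-p2 g4, p512xxx-lineage) VERBATIM with the package's
(41)-side API read off the core's FIELDS (`runCore.steps k hk`, `termRows`, `minRows`, the AC tower `T`, `toTowerBase`) — bundled as `coreV3_dataRows` /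
`coreV3_towerFacts` — instead of `PkgAtV3.<api>`; the old datum is the instance `dataOfV3 q π = dataOfCoreV3 (fun K ↦ (q K).toCore) π` (`rfl`).  Part 2
(`…CoreV3FamUpper`): the upper one-step envelope over the core.  Part 3 (`…ChiV3Fam`): the LOWER one-step envelope ON PRINT'S χ (`PinnedStep.loPrintAC`) from the
χ-record's row `StepAlphaV3ChiAC.fibre57LowOn`, the χ-restricted representation `PrintChi.TwoSidedRepOn … (atHeights (printChiSets …))` (★r1 g2's socket), and the v5kC §2
adapter into `InteriorExcision.regPrIntL_of_dataOnPrintChi`.  Nothing of [Balaban1985UV3] is asserted; CONDITIONAL on the family `p` (data carrying its rows).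

References: T. Bałaban, CMP 102 (1985) 255–275 [Balaban1985UV3] ((1)–(2) p.256, (5) p.256, (7) p.257, (38)–(43) p.266, (46)–(47) p.267, (62) p.271, (64) p.273);
CMP 102 (1985) 277–309 [Balaban1985Variational] (Thm 1 (8) p.279, Prop 7 p.299).
-/

set_option autoImplicit false

noncomputable section

namespace Summit.QuantumFields.YangMills.Theorems

open MeasureTheory Filter
open Literature.MathematicalPhysics.QuantumFieldTheory.Balaban1983to89
open Literature.MathematicalPhysics.QuantumFieldTheory.Balaban1983to89.AveragingRT (rnTransport)
open Literature.MathematicalPhysics.QuantumFieldTheory.Balaban1983to89.B10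
open Literature.MathematicalPhysics.QuantumFieldTheory.Balaban1983to89.B10SectAGathering
open Literature.MathematicalPhysics.QuantumFieldTheory.Balaban1983to89.T3ContinuumYM3Torus
open Literature.MathematicalPhysics.QuantumFieldTheory.Balaban1983to89.T3UnitLawDensityEML (ℰp rt)
open Literature.MathematicalPhysics.QuantumFieldTheory.Balaban1983to89.T3UnitScaleTilt (θBal)
open Literature.MathematicalPhysics.QuantumFieldTheory.Balaban1983to89.T3LevelShift (fieldShift fieldShift_refl)
open Literature.MathematicalPhysics.QuantumFieldTheory.Balaban1983to89.T3PrintedRegularMinimiser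
open Literature.MathematicalPhysics.QuantumFieldTheory.Balaban1983to89.T3PrintedMinimiserExistence (regFibrePr_mono minActionRegPr_eq_of_isMinOn)
open Literature.MathematicalPhysics.QuantumFieldTheory.Balaban1983to89.T3AlphaInputsAC
open Literature.MathematicalPhysics.QuantumFieldTheory.Balaban1983to89.T3AlphaInputsACTrivEnvelope
open Literature.MathematicalPhysics.QuantumFieldTheory.Balaban1983to89.Missing (boltzmann)
open Literature.MathematicalPhysics.QuantumFieldTheory.Balaban1985CMP102
open Literature.MathematicalPhysics.QuantumFieldTheory.Balaban1985CMP102.Setting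
open Summit.QuantumFields.Balaban3D.Carriers
open Summit.QuantumFields.Balaban3D.Proofs.Primitives
open Summit.QuantumFields.Balaban3D.Proofs.TowerAC
open Summit.QuantumFields.Balaban3D.Proofs.StandardAC
open Summit.QuantumFields.Balaban3D.Proofs.InputsAC
open Summit.QuantumFields.Balaban3D.Proofs.Inputs (rcoefOf_carrier)
open Summit.QuantumFields.Balaban3D.Proofs.TowerFactsAC
open Summit.QuantumFields.Balaban3D.Proofs.Bound55AC
open Summit.QuantumFields.Balaban3D.Proofs.Thm2AC
open Summit.QuantumFields.Balaban3D.Proofs (Bound55Std.measurable_actionEta Bound55Std.actionEta_nonneg)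
open Summit.QuantumFields.YangMills.Theorems.LogComparisonRepAtHeights
open Summit.QuantumFields.YangMills.Theorems.AlphaV3AC

variable {F : T3Family} {𝔠 : AlphaConsts F.L (suGroupModel 2).N} {γ : ℝ} {hγ : 0 < γ} {hγ1 : γ ≤ (min 𝔠.gamma0 1) ^ 2}
  (p : ∀ K, AlphaInputsT3AC.PkgCoreV3 F 𝔠 γ hγ hγ1 K) (π : AlphaInputsT3AC.PolymerT3 F)

/-! ## §0 The datum of a family of data cores, and the twins the (A) chain reads -/

/-- **THE DATUM OF A GIVEN FAMILY OF DATA CORES** (`p : ∀ K, PkgCoreV3 F 𝔠 γ hγ hγ1 K`): `AlphaInputsT3AC.dataOfV3`'s field table VERBATIM — it reads the package only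
through the core's fields (`wtP`, `UkH`, the AC tower `T`, `E`; histories/regions the lane's, `Adm := ChargedT3`, polymer fields the parameter `π`).  Both the old family datum
(`dataOfV3 q π`, `q : ∀ K, PkgAtV3 …`, by `rfl`: `dataOfV3_eq_dataOfCoreV3`) and the χ-record's (`dataOfCoreV3 (fun K ↦ (q K).toCore) π`, `q : ∀ K, PkgAtV3Chi …`) are instances.
A DEFINITION; nothing asserted. [cite: Balaban1985UV3, (38)–(43) p.266 and (47) p.267] -/
def AlphaInputsT3AC.dataOfCoreV3 : AlphaDataT3 F γ where
  Hist := fun K j => Hist (F.P K) j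
  triv := fun K j => Hist.triv (F.P K) j
  Ω := fun K j hh i => Omega 𝔠.lane.carrier.M₁
    (rcolOf (T3Scales F γ hγ (hγ1.trans (sq_min_one_le _ 𝔠.gamma0_pos)) K) 𝔠.lane.carrier) j hh i
  Adm := fun K j hh W => ChargedT3 F γ 𝔠.b₀ 𝔠.p₀ (avgWindowFactor F.L) K 𝔠.lane.carrier.M₁
    (rcolOf (T3Scales F γ hγ (hγ1.trans (sq_min_one_le _ 𝔠.gamma0_pos)) K) 𝔠.lane.carrier) j hh W
  LF := fun K j W Φ => ∑ r : Hist (F.P K) j, (p K).wtP j r W * Real.exp (Φ r)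
  Umin := fun K j hh W => (p K).UkH j hh W
  mainT := fun K j hh W => (p K).T.mainT j hh W
  Pint := fun K j hh W => (p K).T.Pint j hh W
  Loc := π.Loc
  Pterm := π.Pterm
  enl := π.enl
  treeLen := π.treeLen
  Zterm := fun K j hh => (p K).T.Zterm j hh
  χ := fun K j W => (p K).T.χ j W
  Estep := fun K i => (p K).T.Estep i
  Ecst := fun K j => (p K).T.Ecst j - (p K).E
  Rm := fun K j => (p K).T.Rm j

/-- **THE OLD v3 DATUM IS THE CORE DATUM OF THE PROJECTED FAMILY** (definitional: `dataOfV3 p π` reads the package only through the core's fields). [cite: Balaban1985UV3, (38)–(43) p.266] -/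
theorem AlphaInputsT3AC.dataOfV3_eq_dataOfCoreV3 (q : ∀ K, AlphaInputsT3AC.PkgAtV3 F 𝔠 γ hγ hγ1 K) (π : AlphaInputsT3AC.PolymerT3 F) :
    AlphaInputsT3AC.dataOfV3 q π = AlphaInputsT3AC.dataOfCoreV3 (fun K => (q K).toCore) π :=
  rfl

/-! ### Private bundles of the core's data rows and tower bookkeeping (the (41)-side API of `AlphaInputsT3ACv3` §3, read off the core's FIELDS) -/

/-- Data rows of the core at every `k ≤ K` (steps below the top, terminal row at the top): `U_k(·,h)` measurable, `Pint_k(h,·)` measurable and `≤ cP_k`.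
[cite: Balaban1985UV3, (42)–(43) p.266 and (46) p.267] -/
theorem coreV3_dataRows {K : ℕ} (q : AlphaInputsT3AC.PkgCoreV3 F 𝔠 γ hγ hγ1 K) (k : ℕ) (hk : k ≤ K) (h : Hist (F.P K) k) :
    Measurable (q.UkH k h) ∧ Measurable ((inputOfAC 𝔠.lane q.X q.𝔖).Pint k h) ∧
      ∀ U : GaugeField (F.P K) k (Matrix.specialUnitaryGroup (Fin 2) ℂ), (inputOfAC 𝔠.lane q.X q.𝔖).Pint k h U ≤ q.𝔄.cP k := by
  rcases Nat.lt_or_eq_of_le hk with hlt | rfl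
  · exact ⟨(q.runCore.steps k hlt).hU h, (q.runCore.steps k hlt).hPm h, fun U => (q.runCore.steps k hlt).hPb h U⟩
  · exact ⟨q.termRows.1 h, q.termRows.2.1 h, fun U => q.termRows.2.2 h U⟩

/-- Tower bookkeeping of the core at every `j ≤ K`: `ε₁(j) = θBal(K−j) > 0`, `E_j − E = −Σ_{i<j} E^{(i)}`, and the closed form of `Rm_j`
(`AlphaInputsT3ACv3` §3's `eps1_eq`/`θBal_pos`/`Ecst_sub_E_eq`/`Rm_eq`, proofs verbatim). [cite: Balaban1985UV3, (7) p.257, (41) p.266, (62) p.271 and (64) p.273] -/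
theorem coreV3_towerFacts {K : ℕ} (q : AlphaInputsT3AC.PkgCoreV3 F 𝔠 γ hγ hγ1 K) (j : ℕ) (hj : j ≤ K) :
    (inputOfAC 𝔠.lane q.X q.𝔖).ε₁ j = θBal F.L γ 𝔠.b₀ 𝔠.p₀ (K - j) ∧ 0 < θBal F.L γ 𝔠.b₀ 𝔠.p₀ (K - j) ∧
      q.T.Ecst j - q.E = -∑ i ∈ Finset.range j, q.T.Estep i ∧
      q.T.Rm j = 𝔠.stepConsts.rstar * γ ^ (3 + 𝔠.κ₀) *
        (∑ i ∈ Finset.range j, (((F.L : ℝ)⁻¹) ^ 𝔠.κ₀) ^ (K - i)) * (2 * (F.L : ℝ) ^ F.m) ^ 3 := by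
  have h1 : (inputOfAC 𝔠.lane q.X q.𝔖).ε₁ j = θBal F.L γ 𝔠.b₀ 𝔠.p₀ (K - j) := by
    show (T3Scales F γ hγ (hγ1.trans (sq_min_one_le _ 𝔠.gamma0_pos)) K).gk j *
        B10.pFun 𝔠.b₀ 𝔠.p₀ ((T3Scales F γ hγ (hγ1.trans (sq_min_one_le _ 𝔠.gamma0_pos)) K).gk j) = _
    rw [T3Scales_gk_eq F γ hγ _ K j hj]
    rfl
  refine ⟨h1, ?_, ?_, ?_⟩
  · rw [← h1]
    exact eps1_inputOfAC_pos 𝔠.lane q.X q.𝔖 j hj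
  · have e1 : q.T.Ecst j = ∑ i ∈ Finset.Ico j K, q.T.Estep i := q.T.Ecst_eq j
    have e2 : q.E = ∑ i ∈ Finset.Ico 0 K, q.T.Estep i := rfl
    rw [e1, e2, Finset.range_eq_Ico, ← Finset.sum_Ico_consecutive _ (Nat.zero_le j) hj]
    ring
  · have hg2 : (T3Scales F γ hγ (hγ1.trans (sq_min_one_le _ 𝔠.gamma0_pos)) K).g ^ 2 = γ := Real.sq_sqrt hγ.le
    show ∑ i ∈ Finset.range j, rcoefOf _ 𝔠.lane.carrier i *
        ((F.L : ℝ) ^ i * (T3Scales F γ hγ (hγ1.trans (sq_min_one_le _ 𝔠.gamma0_pos)) K).ε) ^ (3 + 𝔠.κ₀) *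
          (T3Scales F γ hγ (hγ1.trans (sq_min_one_le _ 𝔠.gamma0_pos)) K).sites i = _
    rw [Finset.mul_sum, Finset.sum_mul]
    refine Finset.sum_congr rfl fun i hi => ?_
    have hiK : i ≤ K := (Finset.mem_range.mp hi).le.trans hj
    rw [rcoefOf_carrier, hg2, mul_assoc,
      rem_unit_T3Scales F γ hγ (hγ1.trans (sq_min_one_le _ 𝔠.gamma0_pos)) K 𝔠.κ₀ i hiK]
    show 𝔠.stepConsts.rstar * γ ^ (3 + 𝔠.κ₀) * ((((F.L : ℝ)⁻¹) ^ 𝔠.κ₀) ^ (K - i) * (2 * (F.L : ℝ) ^ F.m) ^ 3) = _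
    ring

/-- **`MainTermIsAction`** for the core family datum — EXACT (`PkgAtV3.mainT_eq`). [cite: Balaban1985UV3, (5) p.256 and (41) p.266] -/
theorem AlphaInputsT3AC.dataOfCoreV3_mainTermIsAction : MainTermIsAction (AlphaInputsT3AC.dataOfCoreV3 p π) :=
  fun K j hh W => mainT_towerOfAC_T3_eq 𝔠.lane (p K).X (p K).𝔖 j hh W


/-- The core datum's trivial-history composite minimiser maps are measurable, every `j ≤ K` (for the χ-sockets' `measurableSet_printChiSets`). [cite: Balaban1985UV3, (42) p.266] -/
theorem AlphaInputsT3AC.dataOfCoreV3_measurable_uminTriv (K j : ℕ) (hj : j ≤ K) :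
    Measurable ((AlphaInputsT3AC.dataOfCoreV3 p π).Umin K j ((AlphaInputsT3AC.dataOfCoreV3 p π).triv K j)) :=
  (coreV3_dataRows (p K) j hj (Hist.triv (F.P K) j)).1

/-- **THE `UminTrivIsRegMinimiser` CLAUSES AT A HEIGHT `n < K` for the core family datum — from r1** under the [7] bookkeeping against the member's OWN constants
`θBal(n) ≤ (p K).a₁`, `B₃θBal(n) ≤ ε₀ ≤ (p K).a₀`. [cite: Balaban1985Variational, Thm 1 (8) p.279 and Prop 7 p.299] -/
theorem AlphaInputsT3AC.dataOfCoreV3_uminTriv (K n : ℕ) (hnK : n < K) (ε₀ : ℝ)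
    (ha₁ : θBal F.L γ 𝔠.b₀ 𝔠.p₀ n ≤ (p K).a₁) (hlo : 𝔠.B₃ * θBal F.L γ 𝔠.b₀ 𝔠.p₀ n ≤ ε₀) (hhi : ε₀ ≤ (p K).a₀)
    (V : GaugeField (F.P n) 0 (Matrix.specialUnitaryGroup (Fin 2) ℂ)) (hV : PlaqSmall (θBal F.L γ 𝔠.b₀ 𝔠.p₀ n) V) :
    (AlphaInputsT3AC.dataOfCoreV3 p π).Umin K (K - n) ((AlphaInputsT3AC.dataOfCoreV3 p π).triv K (K - n))
        (fieldShift (F.sitesPerDir_eq (m := F.m) (K := K) (j := K - n) (m' := F.m) (K' := n) (j' := 0) (by omega)) V) ∈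
      regFibrePr F n K hnK.le ε₀ V ∧
    wilsonAction4 ((AlphaInputsT3AC.dataOfCoreV3 p π).Umin K (K - n) ((AlphaInputsT3AC.dataOfCoreV3 p π).triv K (K - n))
        (fieldShift (F.sitesPerDir_eq (m := F.m) (K := K) (j := K - n) (m' := F.m) (K' := n) (j' := 0) (by omega)) V)) =
      minActionRegPr F n K hnK.le ε₀ V := by
  have hθ : 0 < θBal F.L γ 𝔠.b₀ 𝔠.p₀ n := by
    have := (coreV3_towerFacts (p K) (K - n) (by omega)).2.1
    rwa [show K - (K - n) = n by omega] at this
  have hr1 := (p K).minRows.1 n hnK _ ε₀ hθ ha₁ hlo hhi V hV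
  exact ⟨regFibrePr_mono F hlo V hr1.1, minActionRegPr_eq_of_isMinOn F (regFibrePr_mono F hlo V hr1.1) hr1.2⟩

/-- **The `EcstBook` identity** for the core family datum: `Ecst K j = −Σ_{i<j} Estep K i`, `j ≤ K`. [cite: Balaban1985UV3, (62) p.271 and (64) p.273] -/
theorem AlphaInputsT3AC.dataOfCoreV3_Ecst_eq (K j : ℕ) (hj : j ≤ K) :
    (AlphaInputsT3AC.dataOfCoreV3 p π).Ecst K j = -∑ i ∈ Finset.range j, (AlphaInputsT3AC.dataOfCoreV3 p π).Estep K i :=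
  (coreV3_towerFacts (p K) j hj).2.2.1

/-- **`RmSize`** for the core family datum with `C = r⋆γ^{3+κ₀}`, `q = L^{−κ₀}` (`PkgAtV3.Rm_eq`). [cite: Balaban1985UV3, (41) p.266 and (5) p.256] -/
theorem AlphaInputsT3AC.dataOfCoreV3_rmSize :
    RmSize (AlphaInputsT3AC.dataOfCoreV3 p π) (𝔠.stepConsts.rstar * γ ^ (3 + 𝔠.κ₀)) (((F.L : ℝ)⁻¹) ^ 𝔠.κ₀) := by
  have hL1 : (1 : ℝ) < F.L := by exact_mod_cast F.hL.2
  have hLi : (0 : ℝ) ≤ (F.L : ℝ)⁻¹ := inv_nonneg.mpr (zero_lt_one.trans hL1).le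
  have hq0 : 0 ≤ ((F.L : ℝ)⁻¹) ^ 𝔠.κ₀ := Real.rpow_nonneg hLi _
  refine ⟨hq0, Real.rpow_lt_one hLi (inv_lt_one_of_one_lt₀ hL1) 𝔠.κ₀_pos, fun K j hj => ?_⟩
  have heq : (AlphaInputsT3AC.dataOfCoreV3 p π).Rm K j = 𝔠.stepConsts.rstar * γ ^ (3 + 𝔠.κ₀) *
      (∑ i ∈ Finset.range j, (((F.L : ℝ)⁻¹) ^ 𝔠.κ₀) ^ (K - i)) * (2 * (F.L : ℝ) ^ F.m) ^ 3 :=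
    (coreV3_towerFacts (p K) j hj).2.2.2
  refine ⟨?_, heq.le⟩
  rw [heq]
  have h3 : 0 ≤ ∑ i ∈ Finset.range j, (((F.L : ℝ)⁻¹) ^ 𝔠.κ₀) ^ (K - i) := Finset.sum_nonneg fun i _ => pow_nonneg hq0 _
  have h4 : 0 ≤ (2 * (F.L : ℝ) ^ F.m) ^ 3 := by positivity
  exact mul_nonneg (mul_nonneg (mul_nonneg 𝔠.stepConsts.rstar_nonneg (Real.rpow_nonneg hγ.le _)) h3) h4

/-- **`χ_j` IS THE INDICATOR OF THE ROUTE'S WINDOW** for the core family datum, `j ≤ K`. [cite: Balaban1985UV3, (47) p.267] -/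
theorem AlphaInputsT3AC.dataOfCoreV3_chi_eq (K j : ℕ) (hj : j ≤ K) (W : GaugeField (F.P K) j (Matrix.specialUnitaryGroup (Fin 2) ℂ)) :
    (AlphaInputsT3AC.dataOfCoreV3 p π).χ K j W = chiSmall Set.univ (θBal F.L γ 𝔠.b₀ 𝔠.p₀ (K - j)) W := by
  rw [← (coreV3_towerFacts (p K) j hj).1]
  rfl

/-- `χ_j(W) = 1` on the window, core family datum. [cite: Balaban1985UV3, (47) p.267] -/
theorem AlphaInputsT3AC.dataOfCoreV3_chi_eq_one_of_plaqSmall (K j : ℕ) (hj : j ≤ K)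
    (W : GaugeField (F.P K) j (Matrix.specialUnitaryGroup (Fin 2) ℂ)) (hW : PlaqSmall (θBal F.L γ 𝔠.b₀ 𝔠.p₀ (K - j)) W) :
    (AlphaInputsT3AC.dataOfCoreV3 p π).χ K j W = 1 := by
  rw [AlphaInputsT3AC.dataOfCoreV3_chi_eq p π K j hj W]
  unfold chiSmall
  rw [if_pos (show PlaqSmallOn Set.univ (θBal F.L γ 𝔠.b₀ 𝔠.p₀ (K - j)) W from fun q _ => hW q)]

/-! ## §1 Level `0` of every run and the base row -/

/-- `U_0(triv, W) = W` for the core datum (the package's `hU0`). [cite: Balaban1985UV3, (1) p.256] -/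
theorem AlphaInputsT3AC.dataOfCoreV3_umin_zero (K : ℕ) (W : GaugeField (F.P K) 0 (Matrix.specialUnitaryGroup (Fin 2) ℂ)) :
    (AlphaInputsT3AC.dataOfCoreV3 p π).Umin K 0 ((AlphaInputsT3AC.dataOfCoreV3 p π).triv K 0) W = W :=
  (p K).hU0 W

/-- `Pint_0 ≡ 0` for the core datum (`pintOfSeries` at level `0`). [cite: Balaban1985UV3, (1) p.256] -/
theorem AlphaInputsT3AC.dataOfCoreV3_pint_zero (K : ℕ) (hh : (AlphaInputsT3AC.dataOfCoreV3 p π).Hist K 0)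
    (W : GaugeField (F.P K) 0 (Matrix.specialUnitaryGroup (Fin 2) ℂ)) :
    (AlphaInputsT3AC.dataOfCoreV3 p π).Pint K 0 hh W = 0 :=
  rfl

/-- `mainT_0(triv, W) = β_K·A(W)` for the core datum (`MainTermIsAction` + `U_0 = id`). [cite: Balaban1985UV3, (1) p.256 and (5) p.256] -/
theorem AlphaInputsT3AC.dataOfCoreV3_mainT_triv_zero (K : ℕ) (W : GaugeField (F.P K) 0 (Matrix.specialUnitaryGroup (Fin 2) ℂ)) :
    (AlphaInputsT3AC.dataOfCoreV3 p π).mainT K 0 ((AlphaInputsT3AC.dataOfCoreV3 p π).triv K 0) W = (F.scheme ℰp γ).β K * wilsonAction4 W := by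
  rw [AlphaInputsT3AC.dataOfCoreV3_mainTermIsAction p π K 0 _ W, AlphaInputsT3AC.dataOfCoreV3_umin_zero p π K W]

/-- `Ecst K 0 = 0` for the core datum (route normalisation). [cite: Balaban1985UV3, (62) p.271 and (64) p.273] -/
theorem AlphaInputsT3AC.dataOfCoreV3_Ecst_zero (K : ℕ) : (AlphaInputsT3AC.dataOfCoreV3 p π).Ecst K 0 = 0 := by
  rw [AlphaInputsT3AC.dataOfCoreV3_Ecst_eq p π K 0 (Nat.zero_le K), Finset.range_zero, Finset.sum_empty, neg_zero]

/-- **`BaseTrivAt` FOR THE v3 DATUM** at every cut-off. [cite: Balaban1985UV3, (1) p.256] -/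
theorem AlphaInputsT3AC.dataOfCoreV3_baseTrivAt (K : ℕ) : BaseTrivAt (AlphaInputsT3AC.dataOfCoreV3 p π) 𝔠.b₀ 𝔠.p₀ K := by
  refine ae_of_all _ fun W _ => ?_
  have hR : 0 ≤ (AlphaInputsT3AC.dataOfCoreV3 p π).Rm K 0 := Rm_nonneg (AlphaInputsT3AC.dataOfCoreV3_rmSize p π) (Nat.zero_le K)
  rw [lowerTriv_eq_exp, upperTriv_eq_exp, AlphaInputsT3AC.dataOfCoreV3_mainT_triv_zero p π K W, AlphaInputsT3AC.dataOfCoreV3_pint_zero p π K _ W,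
    AlphaInputsT3AC.dataOfCoreV3_Ecst_zero p π K]
  unfold boltzmann
  constructor
  · apply Real.exp_le_exp.mpr
    linarith
  · apply Real.exp_le_exp.mpr
    linarith

/-! ## §2 Integrability of the trivial exponentials -/

/-- **`TrivExpIntegrable` FOR THE v3 DATUM**: `e^{−mainT_j(triv) + Pint_j(triv)}` is integrable at every level `j ≤ K` (data rows `PkgAtV3.measurable_UkH`,
`measurable_Pint`, `Pint_le` at every `j ≤ K`; `mainT ≥ 0`). [cite: Balaban1985UV3, (41) p.266] -/
theorem AlphaInputsT3AC.dataOfCoreV3_trivExpIntegrable : TrivExpIntegrable (AlphaInputsT3AC.dataOfCoreV3 p π) := by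
  intro K j hj
  obtain ⟨hU, hPm, hPb⟩ := coreV3_dataRows (p K) j hj (Hist.triv (F.P K) j)
  show Integrable (fun W => Real.exp (-((p K).T.mainT j (Hist.triv (F.P K) j) W) +
    (p K).T.Pint j (Hist.triv (F.P K) j) W)) _
  have hmain : ∀ W : GaugeField (F.P K) j (Matrix.specialUnitaryGroup (Fin 2) ℂ),
      (p K).T.mainT j (Hist.triv (F.P K) j) W =
        ((T3Scales F γ hγ (hγ1.trans (sq_min_one_le _ 𝔠.gamma0_pos)) K).gk j)⁻¹ ^ 2 *
          (T3Scales F γ hγ (hγ1.trans (sq_min_one_le _ 𝔠.gamma0_pos)) K).actionEta j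
            ((p K).UkH j (Hist.triv (F.P K) j) W) := fun _ => rfl
  have h1 := Balaban3D.Proofs.Transport48.integrable_weight_mul_exp (P := F.P K) (G := Matrix.specialUnitaryGroup (Fin 2) ℂ)
    (m := fun _ => (1 : ℝ)) measurable_const (fun _ => zero_le_one) (fun _ => le_rfl)
    (F := fun W => -((p K).T.mainT j (Hist.triv (F.P K) j) W) +
      (p K).T.Pint j (Hist.triv (F.P K) j) W) ?_ (c := (p K).𝔄.cP j) ?_
  · exact h1.congr (ae_of_all _ fun W => one_mul _)
  · simp_rw [hmain]
    exact (measurable_const.mul ((Bound55Std.measurable_actionEta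
      (S := T3Scales F γ hγ (hγ1.trans (sq_min_one_le _ 𝔠.gamma0_pos)) K) j).comp hU)).neg.add hPm
  · intro W
    have h0 : 0 ≤ (p K).T.mainT j (Hist.triv (F.P K) j) W := by
      rw [hmain]
      exact mul_nonneg (sq_nonneg _) (Bound55Std.actionEta_nonneg (S := T3Scales F γ hγ (hγ1.trans (sq_min_one_le _ 𝔠.gamma0_pos)) K) j _)
    have h2 : (p K).T.Pint j (Hist.triv (F.P K) j) W ≤ (p K).𝔄.cP j := hPb W
    linarith

/-! ## §3 The main term at the heights, including the cut-off height `n = K` -/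

/-- At the cut-off height the composite minimiser at the trivial history IS the datum (index bookkeeping + `hU0`). [cite: Balaban1985UV3, (1) p.256] -/
theorem AlphaInputsT3AC.dataOfCoreV3_umin_sub_self (K : ℕ) (V : GaugeField (F.P K) 0 (Matrix.specialUnitaryGroup (Fin 2) ℂ))
    (e : (F.PP F.m K).sitesPerDir (K - K) = (F.PP F.m K).sitesPerDir 0) :
    (AlphaInputsT3AC.dataOfCoreV3 p π).Umin K (K - K) ((AlphaInputsT3AC.dataOfCoreV3 p π).triv K (K - K)) (fieldShift e V) = V := by
  have aux : ∀ (j : ℕ) (hj : j = 0) (e' : (F.PP F.m K).sitesPerDir j = (F.PP F.m K).sitesPerDir 0),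
      (AlphaInputsT3AC.dataOfCoreV3 p π).Umin K j ((AlphaInputsT3AC.dataOfCoreV3 p π).triv K j) (fieldShift e' V) = V := by
    intro j hj e'
    subst hj
    rw [fieldShift_refl]
    exact AlphaInputsT3AC.dataOfCoreV3_umin_zero p π K V
  exact aux (K - K) (Nat.sub_self K) e

/-- **`MainTermAtHeights` FOR THE v3 DATUM** under the adapter's thresholds: for `n < K` by r1 (`dataT3v3_uminTriv`) and `MainTermIsAction`; for `n = K` the fibre
is the datum itself (`minActionRegPr_self_of_plaqSmall`, p502074). [cite: Balaban1985UV3, (42) p.266; Balaban1985Variational, Thm 1 (8) p.279] -/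
theorem AlphaInputsT3AC.dataOfCoreV3_mainTermAtHeights {a₀ a₁ : ℝ} (hp : ∀ K, (p K).a₀ = a₀ ∧ (p K).a₁ = a₁)
    (ε₀ : ℝ) (hε : 0 < ε₀) (hhi : ε₀ ≤ a₀)
    (ha₁ : ∀ n, θBal F.L γ 𝔠.b₀ 𝔠.p₀ n ≤ a₁) (hlo : ∀ n, 𝔠.B₃ * θBal F.L γ 𝔠.b₀ 𝔠.p₀ n ≤ ε₀)
    (h4 : ∀ n, 4 * θBal F.L γ 𝔠.b₀ 𝔠.p₀ n < ε₀) :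
    MainTermAtHeights (AlphaInputsT3AC.dataOfCoreV3 p π) 𝔠.b₀ 𝔠.p₀ ε₀ := by
  intro K n hn V hV
  rw [AlphaInputsT3AC.dataOfCoreV3_mainTermIsAction p π]
  congr 1
  rcases Nat.lt_or_eq_of_le hn with hlt | heq
  · exact (AlphaInputsT3AC.dataOfCoreV3_uminTriv p π K n hlt ε₀ ((hp K).2.symm ▸ ha₁ n) (hlo n) ((hp K).1.symm ▸ hhi) V hV).2
  · subst heq
    rw [AlphaInputsT3AC.dataOfCoreV3_umin_sub_self p π n V]
    exact (minActionRegPr_self_of_plaqSmall (F := F) hn hε V hV (h4 n)).symm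

end Summit.QuantumFields.YangMills.Theorems

end
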